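import Summits.CriticalPhenomena.CardyFormulaZ2.Theorems.CardyIKTransportIKMixedBoxCrossingQuenchedMixtureDefs

/-!
# Stub `stub_codeIff` (line `defect-closure-exploration` v7 / ALT line `quenched-chain-fkg`, crux `IKMixedBoxCrossing`,
# stmt-CriticalPhenomena-5911): the product structure (C) `CodeIff` of the `D`-even code

Support file (`--supports stmt-CriticalPhenomena-5911`), no new definitions.  For a finite defect set `D` and a black set
`s`, `s` is `D`-even (no face of `D` is an odd face of `1_s`) iff for every component cell set `K ∈ comps D` the trace
`s ∩ K` is a local codeword (`localCode D K`).  Two elementary facts carry the proof: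
* (a) `cellFace_subset_compCells`: the block of a defect face `g ∈ D` lies in the cell set `compCells D ⟨g, _⟩` of its own
  component (reachability in the defect graph is reflexive), and that cell set is a member of `comps D`
  (`compCells_mem_comps`);
* (b) LOCALITY `isOddFace_inter_iff`: the parity of a face `g` reads only the four cells of `cellFace g`
  (`isOddFace_congr` of `…DefectStubGadget`), so `1_s` and `1_{s ∩ K}` have the same parity at `g` as soon as
  `cellFace g ⊆ K`.
(⇒) a trace `s ∩ K` lies in `K`, and a face of `D` with block inside `K` is even for `1_s`, hence for `1_{s ∩ K}` by (b);
(⇐) for `g ∈ D` take `K := compCells D ⟨g, _⟩ ∈ comps D`: by (a) `cellFace g ⊆ K`, the codeword condition makes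
`1_{s ∩ K}` even at `g`, hence `1_s` by (b).  The hypotheses `D ⊆ innerVertices Λ` and `s ⊆ Λ` of `CodeIff` are not needed.
-/

noncomputable section

namespace Summit.CriticalPhenomena.CardyFormulaZ2.Cruxes.IKMixedBoxCrossing.QuenchedChainFKG

open scoped Classical
open Finset
open Literature.Probability.LatticeModels
open Summit.CriticalPhenomena.CardyFormulaZ2.Cruxes.IKMixedBoxCrossing.DefectClosureExploration (isOddFace_congr)

namespace CodeStructure

/-! ## §1 Blocks, components and locality -/

/-- (a) The block of a defect face lies in the cell set of its own component (reachability is reflexive). -/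
theorem cellFace_subset_compCells {D : Finset (Site 2)} {g : Site 2} (hg : g ∈ D) :
    cellFace g ⊆ compCells D ⟨g, hg⟩ := by
  intro x hx
  unfold compCells
  rw [mem_biUnion]
  exact ⟨⟨g, hg⟩, mem_filter.2 ⟨mem_attach _ _, SimpleGraph.Reachable.refl _⟩, hx⟩

/-- The cell set of the component of a defect face is one of the components of `D`. -/
theorem compCells_mem_comps {D : Finset (Site 2)} {g : Site 2} (hg : g ∈ D) :
    compCells D ⟨g, hg⟩ ∈ comps D := by
  unfold comps
  exact mem_image_of_mem _ (mem_attach _ _)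

/-- (b) LOCALITY: the parity of a face whose block lies in `K` is the same for the black set `s` and for its
trace `s ∩ K` (the two indicator colourings agree on the block). -/
theorem isOddFace_inter_iff {s K : Finset (Site 2)} {g : Site 2} (hK : cellFace g ⊆ K) :
    IsOddFace (fun x => decide (x ∈ s ∩ K)) g ↔ IsOddFace (fun x => decide (x ∈ s)) g :=
  isOddFace_congr fun x hx => by simp [mem_inter, hK hx]

/-- (⇒) A `D`-even black set traces a local codeword on every cell set `K` (no component structure needed). -/
theorem inter_mem_localCode {D s : Finset (Site 2)} (h : ∀ g ∈ D, ¬ IsOddFace (fun x => decide (x ∈ s)) g)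
    (K : Finset (Site 2)) : s ∩ K ∈ localCode D K := by
  unfold localCode
  rw [mem_filter, mem_powerset]
  refine ⟨inter_subset_right, fun g hg hgK => ?_⟩
  rw [isOddFace_inter_iff hgK]
  exact h g hg

/-- (⇐) If the trace of `s` on the cell set of the component of `g ∈ D` is a local codeword, then `g` is an even
face of `1_s`. -/
theorem not_isOddFace_of_inter_mem_localCode {D s : Finset (Site 2)} {g : Site 2} (hg : g ∈ D)
    (h : s ∩ compCells D ⟨g, hg⟩ ∈ localCode D (compCells D ⟨g, hg⟩)) :
    ¬ IsOddFace (fun x => decide (x ∈ s)) g := by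
  unfold localCode at h
  rw [mem_filter] at h
  rw [← isOddFace_inter_iff (cellFace_subset_compCells hg)]
  exact h.2 g hg (cellFace_subset_compCells hg)

end CodeStructure

open CodeStructure in
/-- **PRODUCT STRUCTURE OF THE `D`-EVEN CODE** (statement (C) `CodeIff` of `…QuenchedMixtureDefs`): a black set `s` is
`D`-even iff each of its component traces `s ∩ K`, `K ∈ comps D`, is a local codeword of `localCode D K` (the free
cells are unconstrained).  The box hypotheses `D ⊆ innerVertices Λ`, `s ⊆ Λ` are not used. -/
theorem codeIff : CodeIff := by
  intro D Λ _ s _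
  refine ⟨fun h K _ => inter_mem_localCode h K, fun h g hg => ?_⟩
  exact not_isOddFace_of_inter_mem_localCode hg (h _ (compCells_mem_comps hg))

/-- **STUB `stub_codeIff`** (registered signature; = `codeIff`): the product structure of the `D`-even code along the
linked components of `D`, layer (C) of the quenched-mixture programme of line `defect-closure-exploration` v7. -/
theorem stub_codeIff : CodeIff :=
  codeIff

end Summit.CriticalPhenomena.CardyFormulaZ2.Cruxes.IKMixedBoxCrossing.QuenchedChainFKG

end
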